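/-
Literature/AlgebraicGeometry/Pohlmann1968/MixedDifferenceCubeExponentFamilies.lean — pub-hodgecm2 (COR-CM), KEPT Literature lane
lit-deligne-3 gen 68, file F68b.  THEOREMS ONLY (no `def`, no named fact, no `sorry`, no instance, no notation; D-0026 net debt 0).
HC_CM is NOT proved.
-/
import Literature.AlgebraicGeometry.Pohlmann1968.MixedDifferenceCubeBasePoints
import Literature.AlgebraicGeometry.Pohlmann1968.WeilTypeCMSubfieldRankBound
import HarnessLib

/-!
# Sign-normalised exponent families give pairwise distinct coset cubes:
# `dim Bᵐ(A) − dim Dᵐ(A) ≥ [F:ℚ] · Π_i (p_i − 1)/2` (Hazama's count `q(q−1)` for cyclic `2pq` as the case `k = 1`)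

Topic `Literature/AlgebraicGeometry/Pohlmann1968` (namespace `Literature.AlgebraicGeometry.Pohlmann1968.MixedDifferenceCube`); cell
`pub-hodgecm2` (COR-CM), KEPT Literature lane `lit-deligne-3` gen 68, file F68b (sequel of F68a `MixedDifferenceCubeBasePoints`).
KERNEL ONLY (theorems; D-0014 ∕ D-0026 net debt `0`).  HC_CM is NOT proved here or anywhere in the lane.

## Mathematics

SETTING (F67a ∕ F68a).  `K ⊇ F` number fields (`j : F → K`), `Φ` a CM type of `K`, `Aut_ℚ(F)` commutative, `c` its complex conjugation
(`x ∘ c = x̄`), generators `σ_i ∈ Aut_ℚ(F)` with `orderOf σ_i = p_i`, PAIRWISE DISTINCT ODD PRIMES (`i ∈ ι`).  An EXPONENT FAMILY is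
`a = (a_i)`, `1 ≤ a_i + 1 ≤ (p_i − 1)/2` (coded `a_i ∈ Fin (p_i / 2)`), with displaced generators `σ_i^{a_i+1}` (again of order `p_i`);
the cube of bases of `(y, a)` is `X(y, a) = {b_ε(y; σ^{a+1})}`, `b_ε = (s(ε) = 1 ? y : ȳ) ∘ Π_{ε_i} σ_i^{a_i+1}`, and the cube set is
`S(y, a) = {φ : φ|_F ∈ X(y, a)}`.  Replacing `a_i + 1` by `p_i − (a_i + 1)` on a set `T` of indices replaces `X(y, a)` by a cube of
the SAME family of sets with another base point (flip `ε` on `T`: `X(y, a') = X(b_T(y; a), a)` up to relabelling) — so only the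
`Π_i (p_i − 1)/2` sign-normalised families can give new sets, and they do:

(1) **`(y, a) ↦ X(y, a)` IS INJECTIVE** on `Hom(F, ℂ) × Π_i Fin((p_i−1)/2)` (`image_baseFamily_pow_injective`), hence so is
`(y, a) ↦ S(y, a)` (`cubeSet_pow_injective`).  PROOF.  `X(y, a) = X(y', a')` gives `y' = b_∅(y') = y ∘ t_{ε₁}σ^{(a)}_{ε₁}` and, for the
singleton `δ = {i}`, `b_{{i}}(y'; a') ∈ X(y, a)`, i.e. `t · σ^{(a)}_{ε₁} σ_i^{a'_i+1} = t' · σ^{(a)}_{δ'}`; cancelling the `2`-torsion `t, t' ∈ {1, c}`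
against odd orders and comparing exponents of `σ_i` modulo `p_i` (the `σ_j` have pairwise coprime orders, `§1`):
`(a_i+1)[i ∈ ε₁] + (a'_i+1) ≡ (a_i+1)[i ∈ δ'] (mod p_i)`.  With `1 ≤ a_i+1, a'_i+1 ≤ (p_i−1)/2` the only solution is `i ∉ ε₁`, `i ∈ δ'`,
`a'_i = a_i` (the other three cases force `p_i ∣ a'_i + 1` or `p_i ∣ (a_i+1) + (a'_i+1) ≤ p_i − 1`).  So `ε₁ = ∅`, `y' = y`, `a' = a`.

(2) **ALL THESE CUBE SETS HAVE THE SAME CARDINALITY `2^{|ι|}·[K:F]`** (`card_cubeSet_pow_eq`): a union of fibres over `2^{|ι|}` distinct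
bases, all fibres of `Hom(K, ℂ) → Hom(F, ℂ)` having the same size (`Aut(ℂ)` is transitive on `Hom(F, ℂ)`).

(3) **THE COUNT** (`card_mul_prod_le_finrank_sub`, `finrank_mul_prod_le_finrank_sub`).  If `Φ` is PRIMITIVE, `c ≠ 1`, `ι ≠ ∅`, and the mixed
differences of the multiplicities of `Φ|_F` vanish along EVERY family `τ` with `τ_i^{p_i} = 1` (the field-side admissible-kernel condition of
the census, F66a; for `F = K^H` in an abelian CM field equivalent to: all characters of kernel `H` vanish on the type), then on every
realisation `A` of `(K; Φ)`:  **`dim Bᵐ(A) − dim Dᵐ(A) ≥ [F:ℚ] · Π_i ⌊p_i/2⌋ = [F:ℚ] · Π_i (p_i − 1)/2`** at `2m = 2^{|ι|}[K:F]` — every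
`S(y, a)` is balanced (F67a), conjugate-free hence not divisorial (F68a ∕ F67a), and they are pairwise distinct (1).

(4) ABELIAN CM FIELDS (`index_mul_prod_le_finrank_sub_of_forall_sum_char_eq_zero`): `K` abelian CM, `Φ` primitive, `F = K^H` not totally
real, `[G:H] = 2^{k+1}Π p_i^{e_i+1}`, cyclic quotient, all characters of kernel `H` vanishing on the type ⟹
**`dim Bᵐ(A) − dim Dᵐ(A) ≥ [G:H] · Π_i (p_i − 1)/2`**.  HAZAMA'S CASE: `K` cyclic of degree `2pq`, `S ∈ S_p − S_1`, `H` of order `p`,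
`[G:H] = 2q`, `ι = {q}`: `≥ 2q·(q−1)/2 = q(q−1)` nondivisorial classes of codimension `p` — EXACTLY the number of weight-`p`
`{0, ±1}`-vectors `±w_k^{(2q)}`, `w_k^{(2q)} − w_l^{(2q)}` in Hazama's lattice `V_{2q} ∩ ℤ[ℤ/2n] = ⟨w_k^{(2q)} : 1 ≤ k ≤ q−1⟩_ℤ` (Prop. 3.2,
§5), i.e. in that case the bound is the value.

THE PRINT.  F. Hazama [Hazama2003CyclicCM] Prop. 3.2 (pp. 586–587: «`V_{2r} ∩ ℤ[ℤ/2nℤ] = ⟨w_k^{(2r)}; 1 ≤ k ≤ r−1⟩_ℤ`», «the coefficient of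
`[a]` appearing in `w` is equal to `±c_a`») and §5 (pp. 596–597: proper Hodge cycles ↔ nonnegative `h` with `h(a)h(a+n) = 0`,
`⟨h, f_{a+S}⟩ = 0`; «the weight of the inverses `F⁻¹(w_k^{(2q)})` … are equal to `p` … the height of them are equal to one»); B. B. Gordon
[Gordon1999HodgeAVSurvey] 9.2.2 (`dim Bᵐ − dim Dᵐ = #` sporadic `Δ`); S. P. White [White1993SporadicCycles] §4 Lemma 3 (p. 131: the products
`σ^{2n/p_1}⋯σ^{2n/p_t}` have the pairwise different orders `p_1⋯p_t`), Thm. 3; H. Pohlmann [Pohlmann1968] Thm. 1.  PRESEARCH (gen 68, with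
F68a): no printed count of the cube sets for `k ≥ 2`; the identification of Hazama's `q(q−1)` with `[F:ℚ]·(q−1)/2` is the lane's reading
of Prop. 3.2 ∕ §5 (pages read), recorded in the docstrings, not formalised.

## Contents

* §1 (private) `modEq_of_prod_pow_eq` (exponent comparison for generators of pairwise distinct prime orders), `prod_ite_pow_injective`,
  `orderOf_pow_eq_of_lt`, parity helpers.
* §2 **`image_baseFamily_pow_injective`**, **`cubeSet_pow_injective`**, `card_filter_comp_mem_eq_mul` (unions of fibres: `|S_B| = |B|·[K:F]`),
  `card_cubeSet_pow_eq`.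
* §3 **`card_mul_prod_le_finrank_sub`**, **`finrank_mul_prod_le_finrank_sub`** (`[F:ℚ]·Π_i ⌊p_i/2⌋ ≤ dim Bᵐ(A) − dim Dᵐ(A)`).
* §4 **`index_mul_prod_le_finrank_sub_of_forall_sum_char_eq_zero`** (abelian CM fields, glued to F67b ∕ F67c).
  (gen 68 append) `index_mul_prod_le_finrank_sub_of_forall_sum_char_eq_zero_finrank`: the same at the explicit degree `2m = 2^{|ι|}[K:F]`.

HONEST REGISTER.  Elementary (exponent bookkeeping in a finite abelian group, fibre counting) on top of F67a ∕ F67b ∕ F67c ∕ F68a, cited by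
name; no equality `dim Bᵐ − dim Dᵐ = [F:ℚ]·Π(p_i−1)/2` is claimed in general (other balanced non-divisorial `2m`-sets may exist; Hazama's
equality is special to cyclic `2pq`); algebraicity untouched.  HC_CM is NOT proved and not used.

## References

* [Hazama2003CyclicCM] F. Hazama, *Hodge cycles on abelian varieties with complex multiplication by cyclic CM-fields*, J. Math. Sci.
  Univ. Tokyo 10 (2003) 581–598: Prop. 3.2, Thm. 4.8 (iv)–(vi), §5.
* [Gordon1999HodgeAVSurvey] B. B. Gordon, *A survey of the Hodge conjecture for abelian varieties*, §9.2, 9.2.2.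
* [White1993SporadicCycles] S. P. White, *Sporadic cycles on CM abelian varieties*, Compositio Math. 88 (1993), §4 Lemma 3, Thm. 3.
* [Pohlmann1968] H. Pohlmann, *Algebraic cycles on abelian varieties of complex multiplication type*, Ann. of Math. 88 (1968), Thm. 1.
* [Kubota1965] T. Kubota, *On the field extension by complex multiplication*, Trans. AMS 118 (1965), §4 Lemma 2.

## Provenance

Cell `pub-hodgecm2` (COR-CM), KEPT Literature lane `lit-deligne-3` gen 68 (claim COSET-CUBE-EXPONENT-FAMILIES; count-neutral, own lane),
file F68b; neighbours cited by name, nothing restated: F68a `MixedDifferenceCubeBasePoints` (`baseFamily_injective`, `baseFamily_conjugateFree`),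
F67a `MixedDifferenceCubeHodgeClasses` (`isGaloisBalanced_iff_forall_alternatingSum`, `not_mem_pohlmannDivisorSets`), F67b ∕ F67c
`MixedDifferenceCubeAbelianKernels` (`forall_alternatingSum_iff_forall_isGaloisBalanced`,
`forall_sum_char_eq_zero_iff_forall_isGaloisBalanced_of_index_two_pow_mul_primePowers`), `DivisorClassesCMType`
(`finrank_hodgeClassSpan_sub_finrank_divisorClassesSpan`), `NondegenerateCMTypeDivisorClasses` (`isPretransitive_ringEquiv_complex`).
Theorems only; net Literature debt 0.
-/

noncomputable section

open CategoryTheory NumberField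
open scoped IsMulCommutative

namespace Literature.AlgebraicGeometry.Pohlmann1968

namespace MixedDifferenceCube

open Literature.NumberTheory.ComplexMultiplication
open Literature.AlgebraicGeometry.Motives (AbelianVariety CMType)
open Literature.AlgebraicGeometry.HodgeTheory
open Literature.AlgebraicGeometry.ComplexMultiplication (IsCMTypeRealisation)
open Literature.AlgebraicGeometry.VanGeemen1994 (hodgeClassSpan)
open Literature.Barriers.HodgeConjecture (divisorClassesSpan)

open scoped Classical

/-! ## §1 Group lemmas: exponents of generators of pairwise distinct prime orders -/

section GroupLemmas

variable {G : Type} [Group G] [IsMulCommutative G] {ι : Type} [Fintype ι]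

/-- Commuting elements of odd orders have a product of odd order. [folklore] -/
private theorem odd_orderOf_mul' {x y : G} (hx : Odd (orderOf x)) (hy : Odd (orderOf y)) : Odd (orderOf (x * y)) :=
  Odd.of_dvd_nat (Odd.of_dvd_nat (hx.mul hy) (Nat.lcm_dvd_mul _ _)) (Commute.all x y).orderOf_mul_dvd_lcm

/-- `Π_i σ_i^{n_i}` has odd order if the `σ_i` do. [folklore] -/
private theorem odd_orderOf_prod_pow (σ : ι → G) (hodd : ∀ i, Odd (orderOf (σ i))) (n : ι → ℕ) :
    Odd (orderOf (∏ i, σ i ^ n i)) := by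
  refine Finset.prod_induction _ (fun g : G => Odd (orderOf g)) (fun a b ha hb => odd_orderOf_mul' ha hb) ?_ ?_
  · rw [orderOf_one]; exact odd_one
  · intro i _
    exact Odd.of_dvd_nat (hodd i) (orderOf_pow_dvd (n i))

/-- **Cancelling the `2`-torsion against odd orders**: `u² = v² = 1`, `x, y` of odd orders, `u x = v y` ⟹ `x = y` and `u = v`.
(Re-proved; F68a has it privately.) [folklore] -/
private theorem eq_of_mul_eq_mul_of_odd' {u v x y : G} (hu : u * u = 1) (hv : v * v = 1) (hx : Odd (orderOf x))
    (hy : Odd (orderOf y)) (h : u * x = v * y) : x = y ∧ u = v := by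
  have h1 : u * (x * y⁻¹) = v := by rw [← mul_assoc, h, mul_inv_cancel_right]
  have hw : x * y⁻¹ = u⁻¹ * v := by rw [← h1, inv_mul_cancel_left]
  have h2 : (x * y⁻¹) ^ 2 = 1 := by
    rw [hw, mul_pow, inv_pow, pow_two, pow_two, hu, hv, inv_one, one_mul]
  have hoddw : Odd (orderOf (x * y⁻¹)) := by
    have hy' : Odd (orderOf y⁻¹) := by rw [orderOf_inv]; exact hy
    exact odd_orderOf_mul' hx hy'
  have hone : orderOf (x * y⁻¹) = 1 := by
    rcases (Nat.dvd_prime Nat.prime_two).1 (orderOf_dvd_of_pow_eq_one h2) with h' | h'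
    · exact h'
    · exfalso
      rw [h'] at hoddw
      exact (by decide : ¬ Odd 2) hoddw
  have hxy : x = y := mul_inv_eq_one.1 (orderOf_eq_one_iff.1 hone)
  refine ⟨hxy, ?_⟩
  rw [hxy] at h
  exact mul_right_cancel h

/-- The cube products in power form: `Π_{ε_i} σ_i^{e_i} = Π_i σ_i^{ε_i ? e_i : 0}`. [folklore] -/
private theorem prod_ite_pow_eq (σ : ι → G) (e : ι → ℕ) (ε : ι → Bool) :
    (∏ i, (if ε i then σ i ^ e i else 1)) = ∏ i, σ i ^ (if ε i then e i else 0) :=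
  Finset.prod_congr rfl fun i _ => by
    by_cases h : ε i
    · rw [if_pos h, if_pos h]
    · rw [if_neg h, if_neg h, pow_zero]

/-- `(Π σ_i^{n_i})(Π σ_i^{m_i}) = Π σ_i^{n_i + m_i}`. [folklore] -/
private theorem prod_pow_mul_prod_pow (σ : ι → G) (n m : ι → ℕ) :
    (∏ i, σ i ^ n i) * (∏ i, σ i ^ m i) = ∏ i, σ i ^ (n i + m i) := by
  rw [← Finset.prod_mul_distrib]
  exact Finset.prod_congr rfl fun i _ => (pow_add _ _ _).symm

/-- **Exponent comparison**: for generators `σ_i` of pairwise distinct prime orders `p_i`, `Π σ_i^{n_i} = Π σ_i^{m_i}` forces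
`n_i ≡ m_i (mod p_i)` for every `i` (raise to `N = Π_{j ≠ i} p_j`, which kills the other factors and is prime to `p_i`).  White: «the order
of a typical product … is exactly `p_1⋯p_t`». [folklore] -/
private theorem modEq_of_prod_pow_eq {p : ι → ℕ} (hp : ∀ i, (p i).Prime) (hinj : Function.Injective p)
    (σ : ι → G) (hσ : ∀ i, orderOf (σ i) = p i) {n m : ι → ℕ} (h : (∏ i, σ i ^ n i) = ∏ i, σ i ^ m i) (i₀ : ι) :
    n i₀ ≡ m i₀ [MOD p i₀] := by
  set N : ℕ := ∏ j ∈ Finset.univ.erase i₀, p j with hN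
  have hkill : ∀ k : ι → ℕ, (∏ i, σ i ^ k i) ^ N = σ i₀ ^ (k i₀ * N) := by
    intro k
    rw [← Finset.prod_pow]
    rw [Finset.prod_eq_single_of_mem i₀ (Finset.mem_univ _) fun i _ hi => ?_]
    · rw [pow_mul]
    · obtain ⟨t, ht⟩ := Finset.dvd_prod_of_mem p (Finset.mem_erase.2 ⟨hi, Finset.mem_univ i⟩)
      rw [← pow_mul, show k i * N = p i * (k i * t) by rw [show N = p i * t from ht]; ring, pow_mul, ← hσ i,
        pow_orderOf_eq_one, one_pow]
  have hpow : σ i₀ ^ (n i₀ * N) = σ i₀ ^ (m i₀ * N) := by rw [← hkill n, ← hkill m, h]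
  rw [pow_eq_pow_iff_modEq, hσ i₀] at hpow
  have hcop : Nat.Coprime (p i₀) N := by
    rw [hN]
    exact Nat.Coprime.prod_right fun i hi =>
      (Nat.coprime_primes (hp i₀) (hp i)).2 fun h => Finset.ne_of_mem_erase hi (hinj h).symm
  exact Nat.ModEq.cancel_right_of_coprime hcop hpow

/-- **The displaced cubes are injective**: for exponents `e_i` prime to `p_i`, `ε ↦ Π_{ε_i} σ_i^{e_i}` is injective. [folklore] -/
private theorem prod_ite_pow_injective {p : ι → ℕ} (hp : ∀ i, (p i).Prime) (hinj : Function.Injective p)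
    (σ : ι → G) (hσ : ∀ i, orderOf (σ i) = p i) (e : ι → ℕ) (he : ∀ i, ¬ p i ∣ e i) :
    Function.Injective fun ε : ι → Bool => ∏ i, (if ε i then σ i ^ e i else 1) := by
  intro ε ε' h
  simp only at h
  rw [prod_ite_pow_eq, prod_ite_pow_eq] at h
  funext i
  have hmod := modEq_of_prod_pow_eq hp hinj σ hσ h i
  rcases Bool.eq_false_or_eq_true (ε i) with h0 | h0 <;>
    rcases Bool.eq_false_or_eq_true (ε' i) with h0' | h0' <;> rw [h0, h0'] at hmod ⊢
  · simp only [if_true, Bool.false_eq_true, if_false] at hmod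
    exact (he i (Nat.modEq_zero_iff_dvd.1 hmod)).elim
  · simp only [if_true, Bool.false_eq_true, if_false] at hmod
    exact (he i (Nat.modEq_zero_iff_dvd.1 hmod.symm)).elim

omit [IsMulCommutative G] in
/-- `orderOf (x^e) = orderOf x` for `0 < e < orderOf x` prime. [folklore] -/
private theorem orderOf_pow_eq_of_lt {x : G} {q e : ℕ} (hq : q.Prime) (hx : orderOf x = q) (he0 : 0 < e) (he : e < q) :
    orderOf (x ^ e) = q := by
  rw [← hx]
  refine Nat.Coprime.orderOf_pow ?_
  rw [hx]
  exact (Nat.Prime.coprime_iff_not_dvd hq).2 fun h => absurd (Nat.le_of_dvd he0 h) (not_le.2 he)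

/-- `a < q / 2` gives `a + 1 < q`. [folklore] -/
private theorem succ_lt_of_lt_div_two {q a : ℕ} (ha : a < q / 2) : a + 1 < q := by omega

/-- For odd `q`: `a, a' < q / 2` gives `(a+1) + (a'+1) ≤ q − 1 < q`. [folklore] -/
private theorem add_succ_lt_of_lt_div_two {q a a' : ℕ} (hq : Odd q) (ha : a < q / 2) (ha' : a' < q / 2) :
    (a + 1) + (a' + 1) < q := by
  obtain ⟨r, hr⟩ := hq
  omega

end GroupLemmas

/-! ## §2 Exponent families: the cubes `X(y, a)` are pairwise distinct, and all cube sets have the same size -/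

section Exponents

variable {K : Type} [Field K] {F : Type} [Field F] (j : F →+* K) {Φ : CMType K} {ι : Type} [Fintype ι]
  [Algebra ℚ F] [IsMulCommutative (F ≃ₐ[ℚ] F)] {p : ι → ℕ}
  (σ : ι → (F ≃ₐ[ℚ] F)) (c : F ≃ₐ[ℚ] F) (hc : ∀ x : F →+* ℂ, x.comp (c : F →+* F) = ComplexEmbedding.conjugate x)

/-! ### Auxiliary (as in F68a) -/

omit [Fintype ι] in
include hc in
/-- `c² = 1`. [folklore] -/
private theorem c_mul_c' (y : F →+* ℂ) : c * c = 1 := by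
  apply AlgEquiv.ext
  intro a
  have h1 : y.comp ((c * c : F ≃ₐ[ℚ] F) : F →+* F) = y := by
    have : y.comp ((c * c : F ≃ₐ[ℚ] F) : F →+* F) = (y.comp (c : F →+* F)).comp (c : F →+* F) := RingHom.ext fun _ => rfl
    rw [this, hc y, hc (ComplexEmbedding.conjugate y)]
    exact ComplexEmbedding.involutive_conjugate F y
  exact y.injective (RingHom.congr_fun h1 a)

omit [IsMulCommutative (F ≃ₐ[ℚ] F)] [Fintype ι] in
/-- `y ∘ P = y ∘ P'` forces `P = P'`. [folklore] -/
private theorem algEquiv_eq_of_comp_eq'' (y : F →+* ℂ) {P P' : F ≃ₐ[ℚ] F}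
    (h : y.comp P.toRingEquiv.toRingHom = y.comp P'.toRingEquiv.toRingHom) : P = P' := by
  have h' := (RingHom.cancel_left y.injective).1 h
  exact AlgEquiv.ext fun x => RingHom.congr_fun h' x

omit [IsMulCommutative (F ≃ₐ[ℚ] F)] [Fintype ι] in
/-- `(y ∘ P) ∘ Q = y ∘ (P Q)`. [folklore] -/
private theorem comp_comp_eq_comp_mul'' (y : F →+* ℂ) (P Q : F ≃ₐ[ℚ] F) :
    (y.comp P.toRingEquiv.toRingHom).comp Q.toRingEquiv.toRingHom = y.comp (P * Q).toRingEquiv.toRingHom :=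
  RingHom.ext fun _ => rfl

include hc in
/-- `b_ε(y; τ) = y ∘ (t_ε τ_ε)`, `t_ε ∈ {1, c}`, for ANY family `τ`. [cite: Hazama2003CyclicCM, §5 (5.1)–(5.2)] -/
private theorem base_eq_comp' (τ : ι → (F ≃ₐ[ℚ] F)) (y : F →+* ℂ) (ε : ι → Bool) :
    (if (∏ i, (if ε i then (-1 : ℤ) else 1)) = 1 then y else ComplexEmbedding.conjugate y).comp
        (∏ i, (if ε i then τ i else 1)).toRingEquiv.toRingHom =
      y.comp ((if (∏ i, (if ε i then (-1 : ℤ) else 1)) = 1 then (1 : F ≃ₐ[ℚ] F) else c) *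
        ∏ i, (if ε i then τ i else 1)).toRingEquiv.toRingHom := by
  split_ifs with h
  · rw [one_mul]
  · rw [← hc y]
    rfl

/-- The signs square to `1`. [folklore] -/
private theorem sign_mul_sign' (hc2 : c * c = 1) (ε : ι → Bool) :
    (if (∏ i, (if ε i then (-1 : ℤ) else 1)) = 1 then (1 : F ≃ₐ[ℚ] F) else c) *
        (if (∏ i, (if ε i then (-1 : ℤ) else 1)) = 1 then (1 : F ≃ₐ[ℚ] F) else c) = 1 := by
  split_ifs
  · exact one_mul 1
  · exact hc2

/-- `t_∅ = 1`. [folklore] -/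
private theorem sign_empty' :
    (if (∏ i, (if (fun _ => false : ι → Bool) i then (-1 : ℤ) else 1)) = 1 then (1 : F ≃ₐ[ℚ] F) else c) = 1 := by
  simp

/-! ### The injectivity in `(y, a)` -/

include hc in
/-- **SIGN-NORMALISED EXPONENT FAMILIES AND BASE EMBEDDINGS GIVE PAIRWISE DISTINCT CUBES OF BASES.**  For generators `σ_i` of pairwise
distinct odd prime orders `p_i` and complex conjugation `c` of `F`, the map
`(y, a) ↦ X(y, a) = {b_ε(y; σ^{a+1}) : ε}`, `y ∈ Hom(F, ℂ)`, `a_i ∈ Fin((p_i − 1)/2)` (exponent `a_i + 1 ∈ [1, (p_i−1)/2]`), is injective: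
comparing `b_∅` and the singletons `b_{{i}}` of `(y', a')` inside `X(y, a)` modulo the `2`-torsion gives
`(a_i+1)[i ∈ ε₁] + (a'_i+1) ≡ (a_i+1)[i ∈ δ'] (mod p_i)`, solvable in the normalised range only by `i ∉ ε₁`, `a'_i = a_i`.  Hazama
(`k = 1`, cyclic `2pq`): the `2q·(q−1)/2 = q(q−1)` two-coset supports of `±w_k^{(2q)}`, `w_k^{(2q)} − w_l^{(2q)}`.
[cite: Hazama2003CyclicCM, Prop. 3.2 and §5] [cite: White1993SporadicCycles, §4 Lemma 3 (proof)] [cite: Gordon1999HodgeAVSurvey, 9.2.2] -/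
theorem image_baseFamily_pow_injective (hp : ∀ i, (p i).Prime) (hinj : Function.Injective p) (hodd : ∀ i, p i ≠ 2)
    (hσ : ∀ i, orderOf (σ i) = p i) :
    Function.Injective fun ya : (F →+* ℂ) × ((i : ι) → Fin (p i / 2)) =>
      Finset.univ.image fun ε : ι → Bool =>
        (if (∏ i, (if ε i then (-1 : ℤ) else 1)) = 1 then ya.1 else ComplexEmbedding.conjugate ya.1).comp
          (∏ i, (if ε i then σ i ^ ((ya.2 i : ℕ) + 1) else 1)).toRingEquiv.toRingHom := by
  rintro ⟨y, a⟩ ⟨y', a'⟩ h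
  simp only at h
  have hc2 := c_mul_c' c hc y
  have hoddσ : ∀ i, Odd (orderOf (σ i)) := fun i => by rw [hσ i]; exact (hp i).odd_of_ne_two (hodd i)
  -- `y' = y ∘ (t_{ε₁} σ^{(a)}_{ε₁})`
  have hy'mem : y' ∈ Finset.univ.image fun ε : ι → Bool =>
      (if (∏ i, (if ε i then (-1 : ℤ) else 1)) = 1 then y' else ComplexEmbedding.conjugate y').comp
        (∏ i, (if ε i then σ i ^ ((a' i : ℕ) + 1) else 1)).toRingEquiv.toRingHom := by
    refine Finset.mem_image.2 ⟨fun _ => false, Finset.mem_univ _, ?_⟩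
    rw [base_eq_comp' c hc _ y', sign_empty' c]
    simp only [Bool.false_eq_true, if_false, Finset.prod_const_one, mul_one]
    exact RingHom.ext fun _ => rfl
  rw [← h] at hy'mem
  obtain ⟨ε₁, -, hε₁⟩ := Finset.mem_image.1 hy'mem
  rw [base_eq_comp' c hc _ y ε₁] at hε₁
  -- for every `i`: the singleton base `b_{{i}}(y'; a')` lies in `X(y, a)`
  have hstep : ∀ i, ε₁ i = false ∧ a' i = a i := by
    intro i
    set e : ι → Bool := Function.update (fun _ => false) i true with hedef
    have hei : e i = true := by rw [hedef, Function.update_self]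
    have hmem : (if (∏ k, (if e k then (-1 : ℤ) else 1)) = 1 then y' else ComplexEmbedding.conjugate y').comp
        (∏ k, (if e k then σ k ^ ((a' k : ℕ) + 1) else 1)).toRingEquiv.toRingHom ∈ Finset.univ.image fun ε : ι → Bool =>
        (if (∏ k, (if ε k then (-1 : ℤ) else 1)) = 1 then y else ComplexEmbedding.conjugate y).comp
          (∏ k, (if ε k then σ k ^ ((a k : ℕ) + 1) else 1)).toRingEquiv.toRingHom := by
      rw [h]
      exact Finset.mem_image.2 ⟨e, Finset.mem_univ _, rfl⟩
    obtain ⟨δ', -, hδ'⟩ := Finset.mem_image.1 hmem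
    rw [base_eq_comp' c hc _ y δ', base_eq_comp' c hc _ y' e, ← hε₁, comp_comp_eq_comp_mul''] at hδ'
    have hgrp := algEquiv_eq_of_comp_eq'' y hδ'
    -- `(t₁ P₁)(t_e P'_e) = t' P'` ⟹ `P₁ P'_e = P'`
    rw [mul_mul_mul_comm] at hgrp
    have hu : ((if (∏ k, (if ε₁ k then (-1 : ℤ) else 1)) = 1 then (1 : F ≃ₐ[ℚ] F) else c) *
        (if (∏ k, (if e k then (-1 : ℤ) else 1)) = 1 then (1 : F ≃ₐ[ℚ] F) else c)) *
        ((if (∏ k, (if ε₁ k then (-1 : ℤ) else 1)) = 1 then (1 : F ≃ₐ[ℚ] F) else c) *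
        (if (∏ k, (if e k then (-1 : ℤ) else 1)) = 1 then (1 : F ≃ₐ[ℚ] F) else c)) = 1 := by
      rw [mul_mul_mul_comm, sign_mul_sign' c hc2, sign_mul_sign' c hc2, one_mul]
    rw [prod_ite_pow_eq, prod_ite_pow_eq, prod_ite_pow_eq, prod_pow_mul_prod_pow] at hgrp
    obtain ⟨hP, -⟩ := eq_of_mul_eq_mul_of_odd' (sign_mul_sign' c hc2 δ') hu (odd_orderOf_prod_pow σ hoddσ _)
      (odd_orderOf_prod_pow σ hoddσ _) hgrp
    have hmod := (modEq_of_prod_pow_eq hp hinj σ hσ hP i).symm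
    rw [hei, if_pos rfl] at hmod
    have hq : Odd (p i) := (hp i).odd_of_ne_two (hodd i)
    have ha : (a i : ℕ) < p i / 2 := (a i).2
    have ha' : (a' i : ℕ) < p i / 2 := (a' i).2
    rcases Bool.eq_false_or_eq_true (ε₁ i) with h1 | h1 <;>
      rcases Bool.eq_false_or_eq_true (δ' i) with h2 | h2 <;>
      simp only [h1, h2, if_true, Bool.false_eq_true, if_false, zero_add] at hmod
    · -- `i ∈ ε₁`, `i ∈ δ'`: `a'_i + 1 ≡ 0`
      exfalso
      have h0 : (a' i : ℕ) + 1 ≡ 0 [MOD p i] := Nat.ModEq.add_left_cancel' ((a i : ℕ) + 1) (by rwa [add_zero])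
      exact Nat.succ_ne_zero _ (Nat.eq_zero_of_dvd_of_lt (Nat.modEq_zero_iff_dvd.1 h0) (succ_lt_of_lt_div_two ha'))
    · -- `i ∈ ε₁`, `i ∉ δ'`: `(a_i+1) + (a'_i+1) ≡ 0`
      exfalso
      have := Nat.eq_zero_of_dvd_of_lt (Nat.modEq_zero_iff_dvd.1 hmod) (add_succ_lt_of_lt_div_two hq ha ha')
      omega
    · -- `i ∉ ε₁`, `i ∈ δ'`: `a'_i = a_i`
      exact ⟨h1, Fin.ext (Nat.succ_injective
        (Nat.ModEq.eq_of_lt_of_lt hmod (succ_lt_of_lt_div_two ha') (succ_lt_of_lt_div_two ha)))⟩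
    · -- `i ∉ ε₁`, `i ∉ δ'`: `a'_i + 1 ≡ 0`
      exfalso
      exact Nat.succ_ne_zero _ (Nat.eq_zero_of_dvd_of_lt (Nat.modEq_zero_iff_dvd.1 hmod) (succ_lt_of_lt_div_two ha'))
  have hε₁0 : ε₁ = fun _ => false := funext fun i => (hstep i).1
  have haa : a' = a := funext fun i => (hstep i).2
  subst haa
  rw [hε₁0, sign_empty' c] at hε₁
  simp only [Bool.false_eq_true, if_false, Finset.prod_const_one, mul_one] at hε₁
  have hyy : y' = y := by rw [← hε₁]; exact RingHom.ext fun _ => rfl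
  rw [hyy]

variable [NumberField K]

omit [Algebra ℚ F] [IsMulCommutative (F ≃ₐ[ℚ] F)] [Fintype ι] in
/-- Every embedding of the subfield extends. [folklore] -/
private theorem fibre_nonempty'' (x : F →+* ℂ) : ∃ φ : K →+* ℂ, φ.comp j = x := by
  letI : Algebra F K := j.toAlgebra
  letI : Algebra F ℂ := x.toAlgebra
  haveI : CharZero F := j.charZero
  haveI : IsScalarTower ℚ F K := IsScalarTower.of_algebraMap_eq fun q => (map_ratCast j q).symm
  haveI : Algebra.IsAlgebraic F K := Algebra.IsAlgebraic.tower_top (K := ℚ) F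
  let ψ : K →ₐ[F] ℂ := IsAlgClosed.lift
  exact ⟨ψ.toRingHom, ψ.comp_algebraMap⟩

omit [Algebra ℚ F] [IsMulCommutative (F ≃ₐ[ℚ] F)] [Fintype ι] in
/-- `S_B ⊆ S_{B'}` implies `B ⊆ B'` (fibres nonempty). [folklore] -/
private theorem subset_of_filter_subset' {B B' : Finset (F →+* ℂ)}
    (h : (Finset.univ.filter fun φ : K →+* ℂ => φ.comp j ∈ B) ⊆ Finset.univ.filter fun φ : K →+* ℂ => φ.comp j ∈ B') :
    B ⊆ B' := by
  intro x hx
  obtain ⟨φ, hφ⟩ := fibre_nonempty'' j x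
  have hφS : φ ∈ Finset.univ.filter fun φ : K →+* ℂ => φ.comp j ∈ B := by
    simp only [Finset.mem_filter, Finset.mem_univ, true_and, hφ]
    exact hx
  have := h hφS
  simp only [Finset.mem_filter, Finset.mem_univ, true_and, hφ] at this
  exact this

include hc in
/-- **… AND PAIRWISE DISTINCT CUBE SETS**: `(y, a) ↦ S(y, a) = {φ : φ|_F ∈ X(y, a)}` is injective (a union of nonempty fibres determines
its set of bases). [cite: Hazama2003CyclicCM, Prop. 3.2 and §5] [cite: Gordon1999HodgeAVSurvey, 9.2.2] -/
theorem cubeSet_pow_injective (hp : ∀ i, (p i).Prime) (hinj : Function.Injective p) (hodd : ∀ i, p i ≠ 2)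
    (hσ : ∀ i, orderOf (σ i) = p i) :
    Function.Injective fun ya : (F →+* ℂ) × ((i : ι) → Fin (p i / 2)) =>
      Finset.univ.filter fun φ : K →+* ℂ => φ.comp j ∈ Finset.univ.image fun ε : ι → Bool =>
        (if (∏ i, (if ε i then (-1 : ℤ) else 1)) = 1 then ya.1 else ComplexEmbedding.conjugate ya.1).comp
          (∏ i, (if ε i then σ i ^ ((ya.2 i : ℕ) + 1) else 1)).toRingEquiv.toRingHom := by
  intro ya ya' h
  simp only at h
  exact image_baseFamily_pow_injective σ c hc hp hinj hodd hσ
    (Finset.Subset.antisymm (subset_of_filter_subset' j h.le) (subset_of_filter_subset' j h.ge))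

/-! ### All cube sets have the same cardinality -/

omit [Algebra ℚ F] [IsMulCommutative (F ≃ₐ[ℚ] F)] [Fintype ι] in
/-- **All fibres of `Hom(K, ℂ) → Hom(F, ℂ)` have the same size** (`Aut(ℂ)` is transitive on `Hom(F, ℂ)` and `φ ↦ g ∘ φ` maps the fibre
over `x₀` onto the fibre over `g ∘ x₀`). [cite: Gordon1999HodgeAVSurvey, §9.2 (proof)] -/
private theorem card_fibre_eq [NumberField F] (x x₀ : F →+* ℂ) :
    (Finset.univ.filter fun φ : K →+* ℂ => φ.comp j = x).card = (Finset.univ.filter fun φ : K →+* ℂ => φ.comp j = x₀).card := by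
  haveI := isPretransitive_ringEquiv_complex (K := F)
  obtain ⟨g, hg⟩ := MulAction.exists_smul_eq (ℂ ≃+* ℂ) x₀ x
  rw [ringEquiv_smul_def] at hg
  have hg' : (g : ℂ →+* ℂ).comp x₀ = x := hg
  have hinj : Function.Injective fun φ : K →+* ℂ => (g : ℂ →+* ℂ).comp φ := by
    intro φ φ' h
    refine RingHom.ext fun z => g.injective ?_
    have := DFunLike.congr_fun h z
    simpa using this
  have hgg : ∀ ψ : K →+* ℂ, (g : ℂ →+* ℂ).comp ((g.symm : ℂ →+* ℂ).comp ψ) = ψ := fun ψ =>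
    RingHom.ext fun z => by simp
  have hgg' : ∀ z : F →+* ℂ, (g.symm : ℂ →+* ℂ).comp ((g : ℂ →+* ℂ).comp z) = z := fun z =>
    RingHom.ext fun w => by simp
  have heq : (Finset.univ.filter fun φ : K →+* ℂ => φ.comp j = x) =
      (Finset.univ.filter fun φ : K →+* ℂ => φ.comp j = x₀).image fun φ => (g : ℂ →+* ℂ).comp φ := by
    ext φ
    simp only [Finset.mem_filter, Finset.mem_univ, true_and, Finset.mem_image]
    constructor
    · intro hφ
      refine ⟨(g.symm : ℂ →+* ℂ).comp φ, ?_, hgg φ⟩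
      rw [RingHom.comp_assoc, hφ, ← hg', hgg']
    · rintro ⟨ψ, hψ, rfl⟩
      rw [RingHom.comp_assoc, hψ, hg']
  rw [heq, Finset.card_image_of_injective _ hinj]

omit [Algebra ℚ F] [IsMulCommutative (F ≃ₐ[ℚ] F)] [Fintype ι] in
/-- **A union of fibres over `B` has `|B| · [K:F]` elements**: `|S_B| = |B| · |fibre|` (disjoint fibres of equal size).
[cite: Gordon1999HodgeAVSurvey, §9.2] -/
theorem card_filter_comp_mem_eq_mul [NumberField F] (B : Finset (F →+* ℂ)) (x₀ : F →+* ℂ) :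
    (Finset.univ.filter fun φ : K →+* ℂ => φ.comp j ∈ B).card =
      B.card * (Finset.univ.filter fun φ : K →+* ℂ => φ.comp j = x₀).card := by
  have heq : (Finset.univ.filter fun φ : K →+* ℂ => φ.comp j ∈ B) =
      B.biUnion fun x => Finset.univ.filter fun φ : K →+* ℂ => φ.comp j = x := by
    ext φ
    simp only [Finset.mem_filter, Finset.mem_univ, true_and, Finset.mem_biUnion]
    constructor
    · intro h; exact ⟨_, h, rfl⟩
    · rintro ⟨x, hx, hφ⟩; rw [hφ]; exact hx
  rw [heq, Finset.card_biUnion]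
  · rw [Finset.sum_congr rfl fun x _ => card_fibre_eq j x x₀, Finset.sum_const, smul_eq_mul]
  · intro x _ x' _ hne
    refine Finset.disjoint_left.2 fun φ h1 h2 => hne ?_
    simp only [Finset.mem_filter, Finset.mem_univ, true_and] at h1 h2
    rw [← h1, ← h2]

include hc in
/-- **ALL CUBE SETS `S(y, a)` HAVE THE SAME CARDINALITY** (`= 2^{|ι|}·[K:F]`): injective bases (`2^{|ι|}` of them, F68a
`baseFamily_injective`) and fibres of equal size. [cite: Gordon1999HodgeAVSurvey, §9.2] [cite: Hazama2003CyclicCM, §5] -/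
theorem card_cubeSet_pow_eq [NumberField F] (hp : ∀ i, (p i).Prime) (hinj : Function.Injective p) (hodd : ∀ i, p i ≠ 2)
    (hσ : ∀ i, orderOf (σ i) = p i) (y : F →+* ℂ) (a : (i : ι) → Fin (p i / 2)) (y₀ : F →+* ℂ) :
    (Finset.univ.filter fun φ : K →+* ℂ => φ.comp j ∈ Finset.univ.image fun ε : ι → Bool =>
        (if (∏ i, (if ε i then (-1 : ℤ) else 1)) = 1 then y else ComplexEmbedding.conjugate y).comp
          (∏ i, (if ε i then σ i ^ ((a i : ℕ) + 1) else 1)).toRingEquiv.toRingHom).card =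
      (Finset.univ.filter fun φ : K →+* ℂ => φ.comp j ∈ Finset.univ.image fun ε : ι → Bool =>
        (if (∏ i, (if ε i then (-1 : ℤ) else 1)) = 1 then y₀ else ComplexEmbedding.conjugate y₀).comp
          (∏ i, (if ε i then σ i else 1)).toRingEquiv.toRingHom).card := by
  have hoddσ : ∀ i, Odd (orderOf (σ i)) := fun i => by rw [hσ i]; exact (hp i).odd_of_ne_two (hodd i)
  have hodda : ∀ i, Odd (orderOf (σ i ^ ((a i : ℕ) + 1))) := fun i => by
    rw [orderOf_pow_eq_of_lt (hp i) (hσ i) (Nat.succ_pos _) (succ_lt_of_lt_div_two (a i).2)]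
    exact (hp i).odd_of_ne_two (hodd i)
  have hinja := prod_ite_pow_injective hp hinj σ hσ (fun i => (a i : ℕ) + 1)
    fun i hdvd => absurd (Nat.le_of_dvd (Nat.succ_pos _) hdvd) (not_le.2 (succ_lt_of_lt_div_two (a i).2))
  have hinj1 := prod_ite_pow_injective hp hinj σ hσ (fun _ => 1) fun i hdvd => (hp i).one_lt.ne' (Nat.dvd_one.1 hdvd)
  have hinj1' : Function.Injective fun ε : ι → Bool => ∏ i, (if ε i then σ i else 1) := by
    have : (fun ε : ι → Bool => ∏ i, (if ε i then σ i ^ (1 : ℕ) else 1)) = fun ε : ι → Bool => ∏ i, (if ε i then σ i else 1) := by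
      funext ε; simp only [pow_one]
    rw [← this]; exact hinj1
  rw [card_filter_comp_mem_eq_mul j _ y₀, card_filter_comp_mem_eq_mul j _ y₀,
    Finset.card_image_of_injective _ (baseFamily_injective (fun i => σ i ^ ((a i : ℕ) + 1)) c hc hodda hinja y),
    Finset.card_image_of_injective _ (baseFamily_injective σ c hc hoddσ hinj1' y₀)]

end Exponents

/-! ## §3 The count: `dim Bᵐ(A) − dim Dᵐ(A) ≥ [F:ℚ] · Π_i (p_i − 1)/2` -/

section Count

variable {K : Type} [Field K] [NumberField K] [IsCMField K] {F : Type} [Field F] [NumberField F] (j : F →+* K) {Φ : CMType K}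
  {ι : Type} [Fintype ι] [Nonempty ι] [IsMulCommutative (F ≃ₐ[ℚ] F)] {p : ι → ℕ}
  (σ : ι → (F ≃ₐ[ℚ] F)) (c : F ≃ₐ[ℚ] F) (hc : ∀ x : F →+* ℂ, x.comp (c : F →+* F) = ComplexEmbedding.conjugate x)

include hc in
/-- **`dim Bᵐ(A) − dim Dᵐ(A) ≥ |Hom(F, ℂ)| · Π_i ⌊p_i/2⌋`.**  Let `Φ` be a PRIMITIVE CM type of the CM field `K`, `F ⊆ K` a subfield with commutative
`Aut_ℚ(F)` and complex conjugation `c ≠ 1`, `σ_i` generators of pairwise distinct odd prime orders `p_i` (`ι ≠ ∅`), and suppose the mixed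
differences `Σ_ε (−1)^{|ε|} #{φ ∈ Φ : φ|_F = x ∘ τ_ε}` vanish at every `x` for EVERY family `τ` with `τ_i^{p_i} = 1` (the field-side admissible-kernel
condition, F66a).  Then on every realisation `(A, ι_A, θ)` of `(K; Φ)`, at `2m = |S(y₀)| = 2^{|ι|}[K:F]`, the cube sets `S(y, a)` of all base
embeddings `y` and all sign-normalised exponent families `a` are `|Hom(F, ℂ)|·Π_i ⌊p_i/2⌋` PAIRWISE DISTINCT balanced, non-divisorial `2m`-sets, so
`dim Bᵐ(A) − dim Dᵐ(A) ≥ |Hom(F, ℂ)| · Π_i ⌊p_i/2⌋` (Gordon 9.2.2).  Hazama (`k = 1`, cyclic `2pq`): `2q · (q−1)/2 = q(q−1)`, the exact number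
of weight-`p` supports. [cite: Hazama2003CyclicCM, Prop. 3.2, Thm. 4.8 (iv)–(vi), §5] [cite: Gordon1999HodgeAVSurvey, 9.2.2]
[cite: Pohlmann1968, Thm. 1] [cite: White1993SporadicCycles, §4 Lemma 3 and Thm. 3] -/
theorem card_mul_prod_le_finrank_sub (hp : ∀ i, (p i).Prime) (hinj : Function.Injective p) (hodd : ∀ i, p i ≠ 2)
    (hσ : ∀ i, orderOf (σ i) = p i) (hc1 : c ≠ 1) (φ₀ : K →+* ℂ) (hprim : IsPrimitive (ℂ ≃+* ℂ) Φ.1 φ₀)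
    (hall : ∀ τ : ι → (F ≃ₐ[ℚ] F), (∀ i, τ i ^ p i = 1) → ∀ x : F →+* ℂ,
      ∑ ε : ι → Bool, (∏ i, (if ε i then (-1 : ℤ) else 1)) *
        ({φ : K →+* ℂ | φ.comp j = x.comp (∏ i, (if ε i then τ i else 1)).toRingEquiv.toRingHom ∧ φ ∈ Φ.1}.ncard : ℤ) = 0)
    (y₀ : F →+* ℂ)
    {A : AbelianVariety ℂ} {ιA : 𝓞 K →+* End A} {θ : K →+* Module.End ℂ (complexBetti A.X 1)}
    (hA : IsCMTypeRealisation Φ A ιA θ) :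
    Fintype.card (F →+* ℂ) * ∏ i, (p i / 2) ≤
      Module.finrank ℂ ↥(hodgeClassSpan (Module.finrank ℚ K / 2) A.X
          {s | s ∈ (Finset.univ.filter fun φ : K →+* ℂ => φ.comp j ∈ Finset.univ.image fun ε : ι → Bool =>
            (if (∏ i, (if ε i then (-1 : ℤ) else 1)) = 1 then y₀ else ComplexEmbedding.conjugate y₀).comp
              (∏ i, (if ε i then σ i else 1)).toRingEquiv.toRingHom) ∧ s ∈ Φ.1}.ncard) -
        Module.finrank ℂ ↥(divisorClassesSpan A.X (Module.finrank ℚ K / 2)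
          {s | s ∈ (Finset.univ.filter fun φ : K →+* ℂ => φ.comp j ∈ Finset.univ.image fun ε : ι → Bool =>
            (if (∏ i, (if ε i then (-1 : ℤ) else 1)) = 1 then y₀ else ComplexEmbedding.conjugate y₀).comp
              (∏ i, (if ε i then σ i else 1)).toRingEquiv.toRingHom) ∧ s ∈ Φ.1}.ncard) := by
  -- the cube sets as a function of `(y, a)`
  set S : (F →+* ℂ) × ((i : ι) → Fin (p i / 2)) → Finset (K →+* ℂ) := fun ya =>
    Finset.univ.filter fun φ : K →+* ℂ => φ.comp j ∈ Finset.univ.image fun ε : ι → Bool =>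
      (if (∏ i, (if ε i then (-1 : ℤ) else 1)) = 1 then ya.1 else ComplexEmbedding.conjugate ya.1).comp
        (∏ i, (if ε i then σ i ^ ((ya.2 i : ℕ) + 1) else 1)).toRingEquiv.toRingHom with hSdef
  set S₀ : Finset (K →+* ℂ) := Finset.univ.filter fun φ : K →+* ℂ => φ.comp j ∈ Finset.univ.image fun ε : ι → Bool =>
      (if (∏ i, (if ε i then (-1 : ℤ) else 1)) = 1 then y₀ else ComplexEmbedding.conjugate y₀).comp
        (∏ i, (if ε i then σ i else 1)).toRingEquiv.toRingHom with hS₀def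
  set m : ℕ := {s | s ∈ S₀ ∧ s ∈ Φ.1}.ncard with hmdef
  rw [finrank_hodgeClassSpan_sub_finrank_divisorClassesSpan hA]
  have hoddσ : ∀ i, Odd (orderOf (σ i)) := fun i => by rw [hσ i]; exact (hp i).odd_of_ne_two (hodd i)
  have hinj1 := prod_ite_pow_injective hp hinj σ hσ (fun _ => 1) fun i hdvd => (hp i).one_lt.ne' (Nat.dvd_one.1 hdvd)
  have hinj1' : Function.Injective fun ε : ι → Bool => ∏ i, (if ε i then σ i else 1) := by
    have : (fun ε : ι → Bool => ∏ i, (if ε i then σ i ^ (1 : ℕ) else 1)) = fun ε : ι → Bool => ∏ i, (if ε i then σ i else 1) := by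
      funext ε; simp only [pow_one]
    rw [← this]; exact hinj1
  -- `S₀` is balanced, so `|S₀| = 2m`
  have hbal₀ : IsGaloisBalanced Φ S₀ :=
    (isGaloisBalanced_iff_forall_alternatingSum j σ (c : F →+* F) hc y₀ _ (fun ε => rfl)
      (baseFamily_injective σ c hc hoddσ hinj1' y₀)).2
      (hall σ fun i => by rw [← hσ i]; exact pow_orderOf_eq_one (σ i))
  -- every `S(y, a)` lies in `pohlmannSets Φ m \ pohlmannDivisorSets Φ m`
  have hmem : ∀ ya, S ya ∈ pohlmannSets Φ m \ pohlmannDivisorSets Φ m := by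
    rintro ⟨y, a⟩
    have hodda : ∀ i, Odd (orderOf (σ i ^ ((a i : ℕ) + 1))) := fun i => by
      rw [orderOf_pow_eq_of_lt (hp i) (hσ i) (Nat.succ_pos _) (succ_lt_of_lt_div_two (a i).2)]
      exact (hp i).odd_of_ne_two (hodd i)
    have hinja := prod_ite_pow_injective hp hinj σ hσ (fun i => (a i : ℕ) + 1)
      fun i hdvd => absurd (Nat.le_of_dvd (Nat.succ_pos _) hdvd) (not_le.2 (succ_lt_of_lt_div_two (a i).2))
    have hσp : ∀ i, σ i ^ p i = 1 := fun i => by rw [← hσ i]; exact pow_orderOf_eq_one (σ i)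
    have hτp : ∀ i, (σ i ^ ((a i : ℕ) + 1)) ^ p i = 1 := fun i => by
      rw [← pow_mul, mul_comm, pow_mul, hσp i, one_pow]
    have hbal : IsGaloisBalanced Φ (S (y, a)) :=
      (isGaloisBalanced_iff_forall_alternatingSum j (fun i => σ i ^ ((a i : ℕ) + 1)) (c : F →+* F) hc y _ (fun ε => rfl)
        (baseFamily_injective (fun i => σ i ^ ((a i : ℕ) + 1)) c hc hodda hinja y)).2 (hall _ hτp)
    refine ⟨⟨?_, hbal⟩, not_mem_pohlmannDivisorSets j _ φ₀ hprim
      (baseFamily_conjugateFree (fun i => σ i ^ ((a i : ℕ) + 1)) c hc hodda hinja hc1 y) m⟩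
    rw [show (S (y, a)).card = S₀.card from card_cubeSet_pow_eq j σ c hc hp hinj hodd hσ y a y₀, hmdef]
    exact hbal₀.card_eq_two_mul
  have hSinj : Function.Injective S := cubeSet_pow_injective j σ c hc hp hinj hodd hσ
  calc Fintype.card (F →+* ℂ) * ∏ i, (p i / 2)
        = Fintype.card ((F →+* ℂ) × ((i : ι) → Fin (p i / 2))) := by
          rw [Fintype.card_prod, Fintype.card_pi]
          simp only [Fintype.card_fin]
    _ = (Finset.univ.image S).card := by rw [Finset.card_image_of_injective _ hSinj, Finset.card_univ]
    _ = (↑(Finset.univ.image S) : Set (Finset (K →+* ℂ))).ncard := (Set.ncard_coe_finset _).symm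
    _ ≤ (pohlmannSets Φ m \ pohlmannDivisorSets Φ m).ncard := by
        refine Set.ncard_le_ncard (fun T hT => ?_)
        obtain ⟨ya, -, rfl⟩ := Finset.mem_image.1 (Finset.mem_coe.1 hT)
        exact hmem ya

include hc in
/-- **`dim Bᵐ(A) − dim Dᵐ(A) ≥ [F:ℚ] · Π_i ⌊p_i/2⌋`** (`|Hom(F, ℂ)| = [F:ℚ]`). [cite: Hazama2003CyclicCM, Prop. 3.2 and §5]
[cite: Gordon1999HodgeAVSurvey, 9.2.2] [cite: Pohlmann1968, Thm. 1] -/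
theorem finrank_mul_prod_le_finrank_sub (hp : ∀ i, (p i).Prime) (hinj : Function.Injective p) (hodd : ∀ i, p i ≠ 2)
    (hσ : ∀ i, orderOf (σ i) = p i) (hc1 : c ≠ 1) (φ₀ : K →+* ℂ) (hprim : IsPrimitive (ℂ ≃+* ℂ) Φ.1 φ₀)
    (hall : ∀ τ : ι → (F ≃ₐ[ℚ] F), (∀ i, τ i ^ p i = 1) → ∀ x : F →+* ℂ,
      ∑ ε : ι → Bool, (∏ i, (if ε i then (-1 : ℤ) else 1)) *
        ({φ : K →+* ℂ | φ.comp j = x.comp (∏ i, (if ε i then τ i else 1)).toRingEquiv.toRingHom ∧ φ ∈ Φ.1}.ncard : ℤ) = 0)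
    (y₀ : F →+* ℂ)
    {A : AbelianVariety ℂ} {ιA : 𝓞 K →+* End A} {θ : K →+* Module.End ℂ (complexBetti A.X 1)}
    (hA : IsCMTypeRealisation Φ A ιA θ) :
    Module.finrank ℚ F * ∏ i, (p i / 2) ≤
      Module.finrank ℂ ↥(hodgeClassSpan (Module.finrank ℚ K / 2) A.X
          {s | s ∈ (Finset.univ.filter fun φ : K →+* ℂ => φ.comp j ∈ Finset.univ.image fun ε : ι → Bool =>
            (if (∏ i, (if ε i then (-1 : ℤ) else 1)) = 1 then y₀ else ComplexEmbedding.conjugate y₀).comp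
              (∏ i, (if ε i then σ i else 1)).toRingEquiv.toRingHom) ∧ s ∈ Φ.1}.ncard) -
        Module.finrank ℂ ↥(divisorClassesSpan A.X (Module.finrank ℚ K / 2)
          {s | s ∈ (Finset.univ.filter fun φ : K →+* ℂ => φ.comp j ∈ Finset.univ.image fun ε : ι → Bool =>
            (if (∏ i, (if ε i then (-1 : ℤ) else 1)) = 1 then y₀ else ComplexEmbedding.conjugate y₀).comp
              (∏ i, (if ε i then σ i else 1)).toRingEquiv.toRingHom) ∧ s ∈ Φ.1}.ncard) := by
  rw [← Embeddings.card F ℂ]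
  exact card_mul_prod_le_finrank_sub j σ c hc hp hinj hodd hσ hc1 φ₀ hprim hall y₀ hA

end Count

/-! ## §4 Abelian CM fields: `[G:H] · Π_i (p_i − 1)/2` exceptional lines from one admissible kernel -/

section Abelian

variable {K : Type} [Field K] [NumberField K] [IsCMField K] [IsAbelianGalois ℚ K]

/-- **`dim Bᵐ(A) − dim Dᵐ(A) ≥ [G:H] · Π_i (p_i − 1)/2` FROM THE CENSUS.**  `K` an abelian CM field, `Φ` a PRIMITIVE CM type read on `Gal(K/ℚ)`
through `φ₀`, `F ⊆ K` not totally real with `H = Gal(K/F)` of index `2^{k+1}·Π_i p_i^{e_i+1}` (`p_i` pairwise distinct odd primes, `ι ≠ ∅`) and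
cyclic quotient, ALL CHARACTERS OF KERNEL `H` VANISHING ON THE TYPE.  Then for every family of generators `σ_i ∈ Gal(F/ℚ)`, `orderOf σ_i = p_i`,
every base embedding `y₀` and EVERY realisation `(A, ι_A, θ)` of `(K; Φ)`:
`dim Bᵐ(A) − dim Dᵐ(A) ≥ [G:H] · Π_i ⌊p_i/2⌋` at `2m = 2^{|ι|}[K:F]` — the coset cubes of all base embeddings and all sign-normalised exponent
families.  HAZAMA'S CASE (`K` cyclic of degree `2pq`, `S ∈ S_p − S_1`, `H` of order `p`, `[G:H] = 2q`, one displacement prime `q`):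
`≥ q(q−1)`, the exact number of supports of the weight-`p` nondivisorial Hodge cycles (`±w_k^{(2q)}`, `w_k^{(2q)} − w_l^{(2q)}`).
[cite: Hazama2003CyclicCM, Prop. 3.2, Thm. 4.8 (iv)–(vi), §5] [cite: Gordon1999HodgeAVSurvey, 9.2.2] [cite: White1993SporadicCycles, §4 Lemma 3 and Thm. 3]
[cite: Kubota1965, §4 Lemma 2] -/
theorem index_mul_prod_le_finrank_sub_of_forall_sum_char_eq_zero (φ₀ : K →+* ℂ) (Φ : CMType K)
    (F : IntermediateField ℚ K) [IsAbelianGalois ℚ F] (hF : ¬ IsTotallyReal F) (k : ℕ) {ι : Type} [Fintype ι] [Nonempty ι]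
    {p e : ι → ℕ} (hp : ∀ i, (p i).Prime) (hinj : Function.Injective p) (hodd : ∀ i, p i ≠ 2)
    (hidx : F.fixingSubgroup.index = 2 ^ (k + 1) * ∏ i, p i ^ (e i + 1)) (hcyc : IsCyclic ((K ≃ₐ[ℚ] K) ⧸ F.fixingSubgroup))
    (hker : ∀ χ : AddChar (Additive (K ≃ₐ[ℚ] K)) ℂ, (∀ g : K ≃ₐ[ℚ] K, χ (Additive.ofMul g) = 1 ↔ g ∈ F.fixingSubgroup) →
        ∑ s ∈ (Finset.univ.filter fun g : K ≃ₐ[ℚ] K => embOf φ₀ g ∈ Φ.1), χ (Additive.ofMul s) = 0)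
    (hprim : IsPrimitive (ℂ ≃+* ℂ) Φ.1 φ₀) (σ : ι → (F ≃ₐ[ℚ] F)) (hσ : ∀ i, orderOf (σ i) = p i) (y₀ : F →+* ℂ)
    {A : AbelianVariety ℂ} {ιA : 𝓞 K →+* End A} {θ : K →+* Module.End ℂ (complexBetti A.X 1)}
    (hA : IsCMTypeRealisation Φ A ιA θ) :
    (2 ^ (k + 1) * ∏ i, p i ^ (e i + 1)) * ∏ i, (p i / 2) ≤
      Module.finrank ℂ ↥(hodgeClassSpan (Module.finrank ℚ K / 2) A.X
          {s | s ∈ (Finset.univ.filter fun φ : K →+* ℂ => φ.comp (algebraMap F K) ∈ Finset.univ.image fun ε : ι → Bool =>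
            (if (∏ i, (if ε i then (-1 : ℤ) else 1)) = 1 then y₀ else ComplexEmbedding.conjugate y₀).comp
              (∏ i, (if ε i then σ i else 1)).toRingEquiv.toRingHom) ∧ s ∈ Φ.1}.ncard) -
        Module.finrank ℂ ↥(divisorClassesSpan A.X (Module.finrank ℚ K / 2)
          {s | s ∈ (Finset.univ.filter fun φ : K →+* ℂ => φ.comp (algebraMap F K) ∈ Finset.univ.image fun ε : ι → Bool =>
            (if (∏ i, (if ε i then (-1 : ℤ) else 1)) = 1 then y₀ else ComplexEmbedding.conjugate y₀).comp
              (∏ i, (if ε i then σ i else 1)).toRingEquiv.toRingHom) ∧ s ∈ Φ.1}.ncard) := by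
  haveI : NumberField F :=
    { to_charZero := inferInstance, to_finiteDimensional := inferInstance }
  have hc1 : conjGalRestrict F ≠ 1 := fun h => hF ((isTotallyReal_iff_conjGalRestrict_eq_one F).2 h)
  have hc : ∀ x : F →+* ℂ, x.comp (conjGalRestrict F : F →+* F) = ComplexEmbedding.conjugate x := fun x => by
    have h := isConj_conjGalRestrict F x
    unfold ComplexEmbedding.IsConj at h
    exact h.symm
  -- characters ⟺ all prime-order cubes balanced (F67c) ⟺ field-side mixed differences along every family `τ^p = 1` (F67b §1)
  have hbal := (forall_sum_char_eq_zero_iff_forall_isGaloisBalanced_of_index_two_pow_mul_primePowers φ₀ Φ F hF k hp hinj hodd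
    hidx hcyc).1 hker
  have hall := (forall_alternatingSum_iff_forall_isGaloisBalanced (algebraMap F K : F →+* K) (Φ := Φ) hp hinj hodd
    (conjGalRestrict F) hc hc1).2 hbal
  rw [← hidx, CMNumbers.index_fixingSubgroup_eq_finrank F]
  exact finrank_mul_prod_le_finrank_sub (algebraMap F K : F →+* K) σ (conjGalRestrict F) hc hp hinj hodd hσ hc1 φ₀ hprim
    hall y₀ hA

/-- **The same count with the degree made explicit: `2m = 2^{|ι|}·[K:F]`** (the cube set is the union of the `2^{|ι|}` fibres over its bases,
each of cardinality `[K:F]` — Milne FT Prop. 2.7 (a), tree `card_fibre_eq_finrank`):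
`dim B^{2^{|ι|−1}[K:F]}(A) − dim D^{2^{|ι|−1}[K:F]}(A) ≥ [G:H] · Π_i ⌊p_i/2⌋`.  Hazama (`|ι| = 1`, `[K:F] = p`): codimension `p`.
[cite: Hazama2003CyclicCM, Prop. 3.2, Thm. 4.8 (iv), §5] [cite: Gordon1999HodgeAVSurvey, 9.2.2] [cite: MilneFT2022, Prop. 2.7 (a)] -/
theorem index_mul_prod_le_finrank_sub_of_forall_sum_char_eq_zero_finrank (φ₀ : K →+* ℂ) (Φ : CMType K)
    (F : IntermediateField ℚ K) [IsAbelianGalois ℚ F] (hF : ¬ IsTotallyReal F) (k : ℕ) {ι : Type} [Fintype ι] [Nonempty ι]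
    {p e : ι → ℕ} (hp : ∀ i, (p i).Prime) (hinj : Function.Injective p) (hodd : ∀ i, p i ≠ 2)
    (hidx : F.fixingSubgroup.index = 2 ^ (k + 1) * ∏ i, p i ^ (e i + 1)) (hcyc : IsCyclic ((K ≃ₐ[ℚ] K) ⧸ F.fixingSubgroup))
    (hker : ∀ χ : AddChar (Additive (K ≃ₐ[ℚ] K)) ℂ, (∀ g : K ≃ₐ[ℚ] K, χ (Additive.ofMul g) = 1 ↔ g ∈ F.fixingSubgroup) →
        ∑ s ∈ (Finset.univ.filter fun g : K ≃ₐ[ℚ] K => embOf φ₀ g ∈ Φ.1), χ (Additive.ofMul s) = 0)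
    (hprim : IsPrimitive (ℂ ≃+* ℂ) Φ.1 φ₀) (σ : ι → (F ≃ₐ[ℚ] F)) (hσ : ∀ i, orderOf (σ i) = p i)
    {A : AbelianVariety ℂ} {ιA : 𝓞 K →+* End A} {θ : K →+* Module.End ℂ (complexBetti A.X 1)}
    (hA : IsCMTypeRealisation Φ A ιA θ) :
    (2 ^ (k + 1) * ∏ i, p i ^ (e i + 1)) * ∏ i, (p i / 2) ≤
      Module.finrank ℂ ↥(hodgeClassSpan (Module.finrank ℚ K / 2) A.X (2 ^ (Fintype.card ι - 1) * Module.finrank F K)) -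
        Module.finrank ℂ ↥(divisorClassesSpan A.X (Module.finrank ℚ K / 2) (2 ^ (Fintype.card ι - 1) * Module.finrank F K)) := by
  haveI : NumberField F :=
    { to_charZero := inferInstance, to_finiteDimensional := inferInstance }
  obtain ⟨y₀⟩ : Nonempty (F →+* ℂ) := inferInstance
  have hc1 : conjGalRestrict F ≠ 1 := fun h => hF ((isTotallyReal_iff_conjGalRestrict_eq_one F).2 h)
  have hc : ∀ x : F →+* ℂ, x.comp (conjGalRestrict F : F →+* F) = ComplexEmbedding.conjugate x := fun x => by
    have h := isConj_conjGalRestrict F x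
    unfold ComplexEmbedding.IsConj at h
    exact h.symm
  have hoddσ : ∀ i, Odd (orderOf (σ i)) := fun i => by rw [hσ i]; exact (hp i).odd_of_ne_two (hodd i)
  have hinj1 := prod_ite_pow_injective hp hinj σ hσ (fun _ => 1) fun i hdvd => (hp i).one_lt.ne' (Nat.dvd_one.1 hdvd)
  have hinj1' : Function.Injective fun ε : ι → Bool => ∏ i, (if ε i then σ i else 1) := by
    have : (fun ε : ι → Bool => ∏ i, (if ε i then σ i ^ (1 : ℕ) else 1)) = fun ε : ι → Bool => ∏ i, (if ε i then σ i else 1) := by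
      funext ε; simp only [pow_one]
    rw [← this]; exact hinj1
  -- the base cube set `S(y₀)` is balanced, so `|S(y₀)| = 2 · #(S(y₀) ∩ Φ)`; and `|S(y₀)| = 2^{|ι|}·[K:F]`
  have hbal := (forall_sum_char_eq_zero_iff_forall_isGaloisBalanced_of_index_two_pow_mul_primePowers φ₀ Φ F hF k hp hinj hodd
    hidx hcyc).1 hker σ hσ y₀
  have h2 := hbal.card_eq_two_mul
  rw [card_filter_comp_mem_eq_mul (algebraMap F K : F →+* K) _ y₀,
    Finset.card_image_of_injective _ (baseFamily_injective σ (conjGalRestrict F) hc hoddσ hinj1' y₀), Finset.card_univ,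
    Fintype.card_fun, Fintype.card_bool, card_fibre_eq_finrank (K := K) y₀] at h2
  have hι : 1 ≤ Fintype.card ι := Fintype.card_pos
  have hm : {s | s ∈ (Finset.univ.filter fun φ : K →+* ℂ => φ.comp (algebraMap F K) ∈ Finset.univ.image fun ε : ι → Bool =>
        (if (∏ i, (if ε i then (-1 : ℤ) else 1)) = 1 then y₀ else ComplexEmbedding.conjugate y₀).comp
          (∏ i, (if ε i then σ i else 1)).toRingEquiv.toRingHom) ∧ s ∈ Φ.1}.ncard =
      2 ^ (Fintype.card ι - 1) * Module.finrank F K := by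
    have hpow : 2 ^ Fintype.card ι = 2 * 2 ^ (Fintype.card ι - 1) := by
      rw [← pow_succ', Nat.sub_add_cancel hι]
    rw [hpow, mul_assoc] at h2
    exact (Nat.eq_of_mul_eq_mul_left two_pos h2).symm
  have h := index_mul_prod_le_finrank_sub_of_forall_sum_char_eq_zero φ₀ Φ F hF k hp hinj hodd hidx hcyc hker hprim σ hσ y₀ hA
  rwa [hm] at h

end Abelian

end MixedDifferenceCube

end Literature.AlgebraicGeometry.Pohlmann1968
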